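import Summits.HodgeConjecture.HodgeConjecture.Theorems.Ring2AbelianAllWeilFieldCM
import HarnessLib

/-!
# Ring 2 · AbelianAll (ab-weil-1, gen 10, part 8e) — linear algebra of `K`-frames: the twisted form
  `H_ε = B(·, φ^*·) + ε B`, base change by a `K_d`-matrix, and the standard `4n`-frame

research route, not a corollary; conditional on HC_CM plus one named minimal statement.
Cell line: research route conditional on HC_CM; not a corollary; Q11.4-sentence-2 already refuted in dim ≥ 3.
`HC_CM` (`Theses.RankFourFaces.CMAbelianHodge`) does not occur in this file; nothing about abelian varieties is
proved here — this is the abstract linear algebra consumed by part 8f (`Ring2AbelianAllWeilSimilarCells`: "same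
discriminant class ⟹ `Motives.IsWeilSimilar`").

## Content (0 sorry)

For a `ℂ`-module `V` with an operator `T` (`T² = -d`) and a bilinear form `B` with `B(Tv, Tw) = d B(v, w)`,
`B(Tv, w) = -B(v, Tw)` (the scalar polarization form of a Weil-type carrier, `T = φ^*`):
* §1 the TWISTED FORM `twistedForm B T ε = B(·, T·) + ε B` (`ε² = -d`): `H_ε(Tv, w) = -ε H_ε(v, w)`,
  `H_ε(v, Tw) = ε H_ε(v, w)` — the complexification of van Geemen's `K`-Hermitian form `H = E(x, √-d y) + √-d E`
  read through the embedding `√-d ↦ ε`;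
* §2 BASE CHANGE of a `K`-frame: for `y_j = Σ_l (P_lj x_l + R_lj T x_l)` the twisted Gram matrix transforms as
  `H_ε(y_i, y_j) = [ᵗ(P - εR) · H_ε(x, x) · (P + εR)]_ij` (`twistedGram_frame_change`), and the linear version in
  one variable (`twistedForm_sum_left`);
* §3 a LINEAR-INDEPENDENCE criterion: if two twisted forms with `ε₁ ≠ ε₂` have non-singular Gram matrices on a
  family `y`, then `(y, Ty)` is linearly independent (`linearIndependent_sum_elim_of_twistedGram_det_ne_zero`);
* §4 the image of a `K_d`-congruence `ᵗσ(g) Ψ g = Ψ'` of van Geemen Gram matrices under a complex embedding `τ`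
  (`map_embedding_congr`), and the extraction of rational parts from `s + ε t = s' + ε t'` (`ε = iy`, `y ≠ 0`,
  `s, t, s', t'` real);
* §5 the STANDARD `4n`-FRAME `(y, Ty)` indexed by `Fin (4n)` (`finPairEquiv`), the standard matrix of `T`
  (`weilStdEndMatrix n d`, blocks `[[0, -d], [1, 0]]`) and the standard Gram matrix (`weilStdGramMatrix n d a b`,
  blocks `[[b, a], [-a, d b]]`) with their defining identities (`pairFrame_end`, `pairFrame_gram`).

## References

* [vanGeemen1994HodgeAV] B. van Geemen, An introduction to the Hodge conjecture for abelian varieties, LNM 1594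
  (1994), Lemma 5.2 (1)–(4).
* [Deligne1982HodgeCycles] P. Deligne, Hodge cycles on abelian varieties, LNM 900 (1982), Lemma 4.6 and the proof
  of Thm. 4.8.
-/

noncomputable section

set_option linter.dupNamespace false

open Polynomial NumberField
open Literature.AlgebraicGeometry.VanGeemen1994

namespace Summit.HodgeConjecture.HodgeConjecture.Ring2.AbelianAll

/-! ### §1 The twisted form -/

section Twisted

variable {V : Type*} [AddCommGroup V] [Module ℂ V]

/-- The twisted form `H_ε(v, w) = B(v, T w) + ε B(v, w)`. [cite: vanGeemen1994HodgeAV, Lemma 5.2 (1)] -/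
def twistedForm (B : V →ₗ[ℂ] V →ₗ[ℂ] ℂ) (T : V →ₗ[ℂ] V) (ε : ℂ) : V →ₗ[ℂ] V →ₗ[ℂ] ℂ :=
  B.compl₂ T + ε • B

/-- Unfolding the twisted form. [cite: vanGeemen1994HodgeAV, Lemma 5.2 (1)] -/
@[simp] theorem twistedForm_apply (B : V →ₗ[ℂ] V →ₗ[ℂ] ℂ) (T : V →ₗ[ℂ] V) (ε : ℂ) (v w : V) :
    twistedForm B T ε v w = B v (T w) + ε * B v w := by
  simp [twistedForm, LinearMap.add_apply, LinearMap.compl₂_apply, LinearMap.smul_apply, smul_eq_mul]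

variable {B : V →ₗ[ℂ] V →ₗ[ℂ] ℂ} {T : V →ₗ[ℂ] V} {ε dC : ℂ}

/-- `H_ε(Tv, w) = -ε H_ε(v, w)` (`σ`-semilinearity in the first variable, `σ(√-d) = -√-d`).
[cite: vanGeemen1994HodgeAV, Lemma 5.2 (1)] -/
theorem twistedForm_T_left (hBTT : ∀ v w, B (T v) (T w) = dC * B v w) (hBT : ∀ v w, B (T v) w = -B v (T w))
    (hε : ε * ε = -dC) (v w : V) : twistedForm B T ε (T v) w = -ε * twistedForm B T ε v w := by
  rw [twistedForm_apply, twistedForm_apply, hBTT, hBT]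
  linear_combination (B v w) * hε

/-- `H_ε(v, Tw) = ε H_ε(v, w)` (linearity in the second variable). [cite: vanGeemen1994HodgeAV, Lemma 5.2 (1)] -/
theorem twistedForm_T_right (hT2 : ∀ v, T (T v) = -(dC • v)) (hε : ε * ε = -dC) (v w : V) :
    twistedForm B T ε v (T w) = ε * twistedForm B T ε v w := by
  rw [twistedForm_apply, twistedForm_apply, hT2, map_neg, map_smul, smul_eq_mul]
  linear_combination (-(B v w)) * hε

end Twisted

/-! ### §2 Base change of a `K`-frame -/

section FrameChange

variable {V : Type*} [AddCommGroup V] [Module ℂ V] (H : V →ₗ[ℂ] V →ₗ[ℂ] ℂ) (T : V →ₗ[ℂ] V) {ε : ℂ}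

/-- `H(Σ_l (c_l x_l + c'_l T x_l), w) = Σ_l (c_l - ε c'_l) H(x_l, w)`. [cite: vanGeemen1994HodgeAV, Lemma 5.2 (1)] -/
theorem twistedForm_sum_left (hl : ∀ v w, H (T v) w = -ε * H v w) {ι : Type*} [Fintype ι] (x : ι → V)
    (c c' : ι → ℂ) (w : V) :
    H (∑ l, (c l • x l + c' l • T (x l))) w = ∑ l, (c l - ε * c' l) * H (x l) w := by
  rw [map_sum, LinearMap.sum_apply]
  refine Finset.sum_congr rfl fun l _ => ?_
  rw [map_add, map_smul, map_smul, LinearMap.add_apply, LinearMap.smul_apply, LinearMap.smul_apply, hl, smul_eq_mul,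
    smul_eq_mul]
  ring

/-- `H(v, Σ_m (c_m x_m + c'_m T x_m)) = Σ_m (c_m + ε c'_m) H(v, x_m)`. [cite: vanGeemen1994HodgeAV, Lemma 5.2 (1)] -/
theorem twistedForm_sum_right (hr : ∀ v w, H v (T w) = ε * H v w) {ι : Type*} [Fintype ι] (x : ι → V)
    (c c' : ι → ℂ) (v : V) :
    H v (∑ m, (c m • x m + c' m • T (x m))) = ∑ m, (c m + ε * c' m) * H v (x m) := by
  rw [map_sum]
  refine Finset.sum_congr rfl fun m _ => ?_
  rw [map_add, map_smul, map_smul, hr, smul_eq_mul, smul_eq_mul]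
  ring

/-- **Base change of the twisted Gram matrix**: for the `K`-frame `y_j = Σ_l (P_lj x_l + R_lj T x_l)`,
`(H(y_i, y_j))_ij = ᵗ(P - εR) · (H(x_l, x_m))_lm · (P + εR)`. [cite: vanGeemen1994HodgeAV, Lemma 5.2 (1)–(3)] -/
theorem twistedGram_frame_change (hl : ∀ v w, H (T v) w = -ε * H v w) (hr : ∀ v w, H v (T w) = ε * H v w)
    {k : ℕ} (x : Fin k → V) (P R : Matrix (Fin k) (Fin k) ℂ) :
    (Matrix.of fun i j => H (∑ l, (P l i • x l + R l i • T (x l))) (∑ m, (P m j • x m + R m j • T (x m)))) =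
      (Matrix.of fun l i => P l i - ε * R l i).transpose * (Matrix.of fun l m => H (x l) (x m)) *
        (Matrix.of fun m j => P m j + ε * R m j) := by
  ext i j
  rw [Matrix.of_apply, twistedForm_sum_left H T hl x (fun l => P l i) (fun l => R l i), Matrix.mul_apply]
  simp_rw [twistedForm_sum_right H T hr x (fun m => P m j) (fun m => R m j), Matrix.mul_apply,
    Matrix.transpose_apply, Matrix.of_apply, Finset.mul_sum, Finset.sum_mul]
  rw [Finset.sum_comm]
  refine Finset.sum_congr rfl fun m _ => Finset.sum_congr rfl fun l _ => ?_
  ring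

end FrameChange

/-! ### §3 Linear independence of `(y, Ty)` from two non-singular twisted Gram matrices -/

section Independence

variable {V : Type*} [AddCommGroup V] [Module ℂ V]

/-- If `H₁(Tv, w) = -ε₁ H₁(v, w)`, `H₂(Tv, w) = -ε₂ H₂(v, w)` with `ε₁ ≠ ε₂` and both Gram matrices
`(H_s(y_i, y_j))` are non-singular, then the family `(y, Ty)` is linearly independent: a relation
`Σ (c_l y_l + c'_l T y_l) = 0` gives `(c - ε_s c') · H_s(y, y) = 0`, so `c - ε₁ c' = c - ε₂ c' = 0`.
[cite: vanGeemen1994HodgeAV, Lemma 5.2 (2)] -/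
theorem linearIndependent_sum_elim_of_twistedGram_det_ne_zero (T : V →ₗ[ℂ] V) (H₁ H₂ : V →ₗ[ℂ] V →ₗ[ℂ] ℂ)
    {ε₁ ε₂ : ℂ} (h₁ : ∀ v w, H₁ (T v) w = -ε₁ * H₁ v w) (h₂ : ∀ v w, H₂ (T v) w = -ε₂ * H₂ v w) (hε : ε₁ ≠ ε₂)
    {k : ℕ} (y : Fin k → V) (hd₁ : (Matrix.of fun i j => H₁ (y i) (y j)).det ≠ 0)
    (hd₂ : (Matrix.of fun i j => H₂ (y i) (y j)).det ≠ 0) :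
    LinearIndependent ℂ (Sum.elim y (fun i => T (y i))) := by
  classical
  rw [Fintype.linearIndependent_iff]
  intro c hc
  have hsum : ∑ l, (c (Sum.inl l) • y l + c (Sum.inr l) • T (y l)) = 0 := by
    rw [Finset.sum_add_distrib]
    simpa only [Fintype.sum_sum_type, Sum.elim_inl, Sum.elim_inr] using hc
  have hvec : ∀ (H : V →ₗ[ℂ] V →ₗ[ℂ] ℂ) (ε : ℂ), (∀ v w, H (T v) w = -ε * H v w) →
      (Matrix.of fun i j => H (y i) (y j)).det ≠ 0 → ∀ l, c (Sum.inl l) - ε * c (Sum.inr l) = 0 := by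
    intro H ε hH hdet
    have hv : Matrix.vecMul (fun l => c (Sum.inl l) - ε * c (Sum.inr l)) (Matrix.of fun i j => H (y i) (y j)) = 0 := by
      funext j
      have h := twistedForm_sum_left H T hH y (fun l => c (Sum.inl l)) (fun l => c (Sum.inr l)) (y j)
      rw [hsum, map_zero, LinearMap.zero_apply] at h
      rw [Pi.zero_apply, Matrix.vecMul, dotProduct]
      simpa only [Matrix.of_apply] using h.symm
    exact fun l => congrFun (Matrix.eq_zero_of_vecMul_eq_zero hdet hv) l
  have e₁ := hvec H₁ ε₁ h₁ hd₁
  have e₂ := hvec H₂ ε₂ h₂ hd₂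
  have hinr : ∀ l, c (Sum.inr l) = 0 := by
    intro l
    have h : (ε₂ - ε₁) * c (Sum.inr l) = 0 := by linear_combination e₁ l - e₂ l
    exact (mul_eq_zero.1 h).resolve_left (sub_ne_zero.2 (Ne.symm hε))
  rintro (l | l)
  · have h := e₁ l
    rwa [hinr l, mul_zero, sub_zero] at h
  · exact hinr l

end Independence

/-! ### §4 Complex embedding of a `K_d`-congruence; extraction of rational parts -/

section Embedding

variable {d : ℕ} [Fact (Irreducible (X ^ 2 + C (d : ℚ) : ℚ[X]))] [IsCMField (weilField d)]

omit [IsCMField (weilField d)] in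
/-- A van Geemen Gram matrix `Ψ = a + b√-d` read through a complex embedding `τ`: `τ(Ψ) = a + τ(√-d) b`.
[cite: vanGeemen1994HodgeAV, Lemma 5.2 (3)] -/
theorem map_embedding_weilGramMatrix {k : ℕ} (τ : weilField d →+* ℂ) (am bm : Matrix (Fin k) (Fin k) ℚ) :
    (weilGramMatrix d am bm).map ⇑τ = Matrix.of fun i j => ((am i j : ℚ) : ℂ) + τ (weilSqrt d) * ((bm i j : ℚ) : ℂ) := by
  ext i j
  rw [Matrix.map_apply, weilGramMatrix_apply, Matrix.of_apply]
  generalize am i j = u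
  generalize bm i j = u'
  simp only [map_add, map_mul, eq_ratCast, map_ratCast]
  ring

omit [IsCMField (weilField d)] in
/-- Its determinant is non-zero as soon as `det Ψ ≠ 0`. [folklore] -/
theorem det_map_embedding_weilGramMatrix_ne_zero {k : ℕ} (τ : weilField d →+* ℂ) {am bm : Matrix (Fin k) (Fin k) ℚ}
    (h0 : (weilGramMatrix d am bm).det ≠ 0) :
    (Matrix.of fun i j => ((am i j : ℚ) : ℂ) + τ (weilSqrt d) * ((bm i j : ℚ) : ℂ)).det ≠ 0 := by
  rw [← map_embedding_weilGramMatrix τ am bm, ← RingHom.mapMatrix_apply, ← RingHom.map_det]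
  exact (map_ne_zero τ).2 h0

/-- **The image of `ᵗσ(g) Ψ g = Ψ'` under a complex embedding `τ`** (`τ(√-d) = ε`, `g = p + r√-d`,
`Ψ = a + b√-d`, `Ψ' = a' + b'√-d` with rational `p, r, a, b, a', b'`):
`ᵗ(p - εr)(a + εb)(p + εr) = a' + εb'` as complex matrices. [cite: vanGeemen1994HodgeAV, Lemma 5.2 (2)–(3)] -/
theorem map_embedding_congr {k : ℕ} {g : Matrix (Fin k) (Fin k) (weilField d)} {p r : Matrix (Fin k) (Fin k) ℚ}
    (hg : ∀ l j, g l j = algebraMap ℚ (weilField d) (p l j) + algebraMap ℚ (weilField d) (r l j) * weilSqrt d)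
    {am bm am' bm' : Matrix (Fin k) (Fin k) ℚ}
    (h : g.transpose.map (IsCMField.complexConj (weilField d)) * weilGramMatrix d am bm * g =
      weilGramMatrix d am' bm')
    (τ : weilField d →+* ℂ) :
    (Matrix.of fun l i => ((p l i : ℚ) : ℂ) - τ (weilSqrt d) * ((r l i : ℚ) : ℂ)).transpose *
        (Matrix.of fun l m => ((am l m : ℚ) : ℂ) + τ (weilSqrt d) * ((bm l m : ℚ) : ℂ)) *
        (Matrix.of fun m j => ((p m j : ℚ) : ℂ) + τ (weilSqrt d) * ((r m j : ℚ) : ℂ)) =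
      Matrix.of fun i j => ((am' i j : ℚ) : ℂ) + τ (weilSqrt d) * ((bm' i j : ℚ) : ℂ) := by
  have hτq : ∀ q : ℚ, τ (algebraMap ℚ (weilField d) q) = (q : ℂ) := embedding_algebraMap τ
  have h' := congrArg (fun M : Matrix (Fin k) (Fin k) (weilField d) => M.map τ) h
  simp only [Matrix.map_mul] at h'
  have e1 : (g.transpose.map (IsCMField.complexConj (weilField d))).map ⇑τ =
      (Matrix.of fun l i => ((p l i : ℚ) : ℂ) - τ (weilSqrt d) * ((r l i : ℚ) : ℂ)).transpose := by
    ext i l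
    rw [Matrix.map_apply, Matrix.map_apply, Matrix.transpose_apply, Matrix.transpose_apply, Matrix.of_apply, hg,
      complexConj_add_mul_weilSqrt, map_sub, map_mul, hτq, hτq, mul_comm (τ (weilSqrt d))]
  have e3 : g.map ⇑τ = Matrix.of fun m j => ((p m j : ℚ) : ℂ) + τ (weilSqrt d) * ((r m j : ℚ) : ℂ) := by
    ext m j
    rw [Matrix.map_apply, Matrix.of_apply, hg, map_add, map_mul, hτq, hτq, mul_comm (τ (weilSqrt d))]
  rw [e1, map_embedding_weilGramMatrix, e3, map_embedding_weilGramMatrix] at h'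
  exact h'

omit [Fact (Irreducible (X ^ 2 + C (d : ℚ) : ℚ[X]))] [IsCMField (weilField d)] in
/-- Extraction of real parts: `s + (iy) t = s' + (iy) t'` with `s, t, s', t'` real and `y ≠ 0` forces `s = s'`,
`t = t'` (`1, √-d` is a `ℚ`-basis of `K_d`, read in `ℂ`). [folklore] -/
theorem eq_and_eq_of_add_mul_eq {s t s' t' : ℂ} (hs : s.im = 0) (ht : t.im = 0) (hs' : s'.im = 0)
    (ht' : t'.im = 0) {y : ℝ} (hy : y ≠ 0)
    (h : s + (Complex.I * (y : ℂ)) * t = s' + (Complex.I * (y : ℂ)) * t') : s = s' ∧ t = t' := by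
  have hre := congrArg Complex.re h
  have him := congrArg Complex.im h
  simp only [Complex.add_re, Complex.mul_re, Complex.I_re, Complex.I_im, Complex.ofReal_re, Complex.ofReal_im,
    Complex.add_im, Complex.mul_im, zero_mul, mul_zero, sub_zero, add_zero, zero_add, one_mul, hs, ht,
    hs', ht'] at hre him
  have htre : t.re = t'.re := mul_left_cancel₀ hy (by linarith)
  refine ⟨Complex.ext hre (by rw [hs, hs']), Complex.ext htre (by rw [ht, ht'])⟩

end Embedding

/-! ### §5 The standard `4n`-frame -/

section PairFrame

/-- `Fin (4n) ≃ Fin (2n) ⊕ Fin (2n)` (first half, second half). [folklore] -/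
def finPairEquiv (n : ℕ) : Fin (4 * n) ≃ Fin (2 * n) ⊕ Fin (2 * n) :=
  (finCongr (by omega : 4 * n = 2 * n + 2 * n)).trans finSumFinEquiv.symm

/-- The standard matrix of `T = φ^*` in a frame `(y, Ty)`: `T y_j = (Ty)_j`, `T (Ty)_j = -d y_j` — blocks
`[[0, -d·1], [1, 0]]`. [cite: Deligne1982HodgeCycles, proof of Thm. 4.8] -/
def weilStdEndMatrix (n d : ℕ) : Matrix (Fin (4 * n)) (Fin (4 * n)) ℚ :=
  (Matrix.fromBlocks (0 : Matrix (Fin (2 * n)) (Fin (2 * n)) ℚ) (-((d : ℚ) • 1)) 1 0).submatrix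
    (finPairEquiv n) (finPairEquiv n)

/-- The standard Gram matrix of `Q_{h_K}` in a frame `(y, Ty)` with `Q(y_i, Ty_j) = a_ij ω`, `Q(y_i, y_j) = b_ij ω`:
blocks `[[b, a], [-a, d b]]`. [cite: vanGeemen1994HodgeAV, Lemma 5.2 (1)] -/
def weilStdGramMatrix (n d : ℕ) (a b : Matrix (Fin (2 * n)) (Fin (2 * n)) ℚ) :
    Matrix (Fin (4 * n)) (Fin (4 * n)) ℚ :=
  (Matrix.fromBlocks b a (-a) ((d : ℚ) • b)).submatrix (finPairEquiv n) (finPairEquiv n)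

variable {V W : Type*} [AddCommGroup V] [Module ℂ V] [AddCommGroup W] [Module ℂ W]

/-- **The matrix of `T` in the standard frame `(y, Ty)`.** [cite: Deligne1982HodgeCycles, proof of Thm. 4.8] -/
theorem pairFrame_end (T : V →ₗ[ℂ] V) {n d : ℕ} (hT2 : ∀ v, T (T v) = -((d : ℂ) • v)) (y : Fin (2 * n) → V)
    (k : Fin (4 * n)) :
    T (Sum.elim y (fun i => T (y i)) (finPairEquiv n k)) =
      ∑ j, ((weilStdEndMatrix n d j k : ℚ) : ℂ) • Sum.elim y (fun i => T (y i)) (finPairEquiv n j) := by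
  classical
  have key : ∀ s : Fin (2 * n) ⊕ Fin (2 * n), T (Sum.elim y (fun i => T (y i)) s) =
      ∑ t : Fin (2 * n) ⊕ Fin (2 * n),
        (((Matrix.fromBlocks (0 : Matrix (Fin (2 * n)) (Fin (2 * n)) ℚ) (-((d : ℚ) • 1)) 1 0) t s : ℚ) : ℂ) •
          Sum.elim y (fun i => T (y i)) t := by
    rintro (i | i)
    · simp [Fintype.sum_sum_type, Matrix.fromBlocks_apply₁₁, Matrix.fromBlocks_apply₂₁, Matrix.one_apply,
        apply_ite (Rat.cast : ℚ → ℂ), ite_smul, Finset.sum_ite_eq']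
    · simp [Fintype.sum_sum_type, Matrix.fromBlocks_apply₁₂, Matrix.fromBlocks_apply₂₂, Matrix.one_apply,
        hT2, Matrix.smul_apply, Matrix.neg_apply, neg_smul, apply_ite (Rat.cast : ℚ → ℂ), ite_smul,
        Finset.sum_ite_eq']
  rw [key (finPairEquiv n k), ← Equiv.sum_comp (finPairEquiv n)]
  rfl

/-- **The Gram matrix of `Q` in the standard frame `(y, Ty)`.** [cite: vanGeemen1994HodgeAV, Lemma 5.2 (1)] -/
theorem pairFrame_gram (T : V →ₗ[ℂ] V) (Q : V →ₗ[ℂ] V →ₗ[ℂ] W) {n d : ℕ}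
    (hQTT : ∀ v w, Q (T v) (T w) = (d : ℂ) • Q v w) (hQT : ∀ v w, Q (T v) w = -Q v (T w))
    (y : Fin (2 * n) → V) (ω : W) (a b : Matrix (Fin (2 * n)) (Fin (2 * n)) ℚ)
    (hQa : ∀ i j, Q (y i) (T (y j)) = ((a i j : ℚ) : ℂ) • ω) (hQb : ∀ i j, Q (y i) (y j) = ((b i j : ℚ) : ℂ) • ω)
    (k l : Fin (4 * n)) :
    Q (Sum.elim y (fun i => T (y i)) (finPairEquiv n k)) (Sum.elim y (fun i => T (y i)) (finPairEquiv n l)) =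
      ((weilStdGramMatrix n d a b k l : ℚ) : ℂ) • ω := by
  have key : ∀ s t : Fin (2 * n) ⊕ Fin (2 * n),
      Q (Sum.elim y (fun i => T (y i)) s) (Sum.elim y (fun i => T (y i)) t) =
        (((Matrix.fromBlocks b a (-a) ((d : ℚ) • b)) s t : ℚ) : ℂ) • ω := by
    rintro (i | i) (j | j)
    · rw [Sum.elim_inl, Sum.elim_inl, Matrix.fromBlocks_apply₁₁, hQb]
    · rw [Sum.elim_inl, Sum.elim_inr, Matrix.fromBlocks_apply₁₂, hQa]
    · rw [Sum.elim_inr, Sum.elim_inl, Matrix.fromBlocks_apply₂₁, hQT, hQa, Matrix.neg_apply, Rat.cast_neg, neg_smul]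
    · rw [Sum.elim_inr, Sum.elim_inr, Matrix.fromBlocks_apply₂₂, hQTT, hQb, Matrix.smul_apply, smul_eq_mul,
        Rat.cast_mul, Rat.cast_natCast, mul_smul]
  rw [key]
  rfl

/-- Linear independence and any pointwise property transfer along `finPairEquiv`. [folklore] -/
theorem pairFrame_linearIndependent (T : V →ₗ[ℂ] V) {n : ℕ} (y : Fin (2 * n) → V)
    (h : LinearIndependent ℂ (Sum.elim y (fun i => T (y i)))) :
    LinearIndependent ℂ (fun k => Sum.elim y (fun i => T (y i)) (finPairEquiv n k)) :=
  (linearIndependent_equiv (finPairEquiv n)).2 h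

/-- A pointwise property of `y` and of `Ty` holds along the standard frame. [folklore] -/
theorem pairFrame_forall {P : V → Prop} (T : V →ₗ[ℂ] V) {n : ℕ} (y : Fin (2 * n) → V) (hy : ∀ i, P (y i))
    (hTy : ∀ i, P (T (y i))) (k : Fin (4 * n)) : P (Sum.elim y (fun i => T (y i)) (finPairEquiv n k)) := by
  rcases finPairEquiv n k with i | i
  · exact hy i
  · exact hTy i

end PairFrame

end Summit.HodgeConjecture.HodgeConjecture.Ring2.AbelianAll

end
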